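import Summits.QuantumFields.YangMills.Theorems.FluctuationComparisonRegPrIntLS1aTowerLawSandwich
import Summits.QuantumFields.YangMills.Theorems.FluctuationComparisonRegPrIntLS1aInvariantVersion
import Literature.MathematicalPhysics.QuantumFieldTheory.Balaban1983to89.B12ContinuousTransportInvariance
import Literature.MathematicalPhysics.QuantumFieldTheory.Balaban1983to89.BalabanUVClass
import HarnessLib

/-!
# S1a · THE ONE-STEP INDUCTIVE FORM OF THE CUT-HEIGHT DOMINATION LETTER `hdomBG_j` (UV3-NODE §69.18 (3)): domination of the run by the cut tower on the
# good data at EVERY height ⟸ ONE-STEP CONDITIONAL PLATEAU LETTERS on the run's consecutive laws, with exponent `Δ_j = Σ_{i ∈ [j,Ts)} η_i`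

Cell `ym3-torus` (YM ladder rung R3 = continuum `SU(2)` Yang–Mills on the three-torus — a RUNG: NOT d = 4, NOT infinite volume, NOT a mass gap, NOT Clay).
Width seat «width 8» `ym3-torus-px8` (gen 26), FREE px helper on crux `stmt-QuantumFields-20520`, count-neutral, DEFINITION-FREE, default heartbeats.

WHY.  The (m)_E node of S1aᴴ (`RunClassMembershipH`, v19 «BACKGROUND WINDOWS») is kernel BY NAME up to displayed letters (UV3-NODE §69.18): the tower door of record
✓`…S1aAlphaPhiMTowerBG.exists_admissible_schedule_phiM_tower_bg` (p831345) turns the (α)-package + five letters + the NEW cut-height letter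
  `hdomBG_j : ∀ V, PlaqSmall θ_j V → (∃ U₀, IsBackground … V U₀ ∧ PlaqSmall (θ_j·L^{−2(K−j)}) U₀) → readAtLevel ρᵗ V ≤ e^{Δ_j} · readAtLevel ρᶜ V`
(«at a datum of the window admitting a fine-small regular minimiser, the RUN's density exceeds the CUT TOWER's by at most `e^{Δ_j}`») into the letter `Φ_m` of the cut
density at every height.  `hdomBG_j` compares two `(Ts−j)`-FOLD integrals (the run integrates all histories above `V`, the cut tower only those weighted by `Π sfCut`); its
supplier was described (§69.18 (3), this lineage) as «one-step small-field CONCENTRATION of the fibre law inside the cut … L, unprinted as a sentence».  THIS FILE performs,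
by kernel and once for all heights, the reduction of that multi-height letter to ONE SENTENCE PER STEP about the RUN ALONE — print's own mechanism ([Balaban1985UV3] (7)
p.257: the decomposition of unity is inserted one level at a time; (47) p.267: every level's restriction `χ_i` costs a factor controlled at that level):

  `(L_i)`  for every measurable `A ⊆ D_i`:  `ν K (i+1) {U | Ū ∈ A} ≤ e^{η_i} · ν K (i+1) {U | Ū ∈ A, U ∈ T_{i+1}}`   (`Ū = descend F ℰp i U`, `j ≤ i < Ts`)

— «GIVEN that the height-`i` average of run `K`'s field is a good datum, the height-`(i+1)` average lies on the good plateau `T_{i+1}` with conditional probability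
`≥ e^{−η_i}`».  Here `D_i` (DOMAINS: where domination is concluded; the supplier takes them OPEN and containing the (E)-good data) and `T_i ⊆ D_i` (TARGETS: measurable,
inside the plateau `{χ_i = 1}` of the cut weight — for the line's `sfCut θ_i` that is `{PlaqSmall-closed (θ_i∕2)}`) are the supplier's choice.  Downward induction on `Ts − j`:
the bottom letter `(L_j)` moves the mass onto `T_{j+1}` at cost `e^{η_j}`; the event «`Ū_j ∈ A` and `U_{j+1} ∈ T_{j+1}`» IS «`U_{j+1} ∈ A′`» with `A′ := descend_j⁻¹ A ∩ T_{j+1}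
⊆ D_{j+1}` because `descend_j ∘ descendTo_{j+1} = descendTo_j` (lit ✓`T3DescentFibreTower.descendTo_descendTo`); the induction hypothesis at `A′` moves the rest; and the
history event «on the targets at every height in `(j, Ts]`» is one on which every cut weight met on the way down equals one, so px21's ✓`…S1aTowerLawSandwich.map_restrict_le_tower`
bounds the restricted descended Gibbs measure by `μ j`.  NO disintegration, NO fibre integral, NO continuity is used before the last (pointwise) step.

WHAT (0 `def`, 0 `sorry`; nothing of Bałaban's asserted — every `η_i` is a HYPOTHESIS letter).
§0 `ofReal_exp_sum_Ico_succ`; ★`sum_Ico_le_geom` — THE BUDGET: `η_i ≤ c·q^i` (`0 ≤ q < 1`) ⟹ `Σ_{i∈[j,Ts)} η_i ≤ (c∕(1−q))·q^j` UNIFORMLY IN `Ts`, the shape `Δ_j ≤ S₁q₁^j` of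
   ✓`…S1aMemOfDominated.admissible_add_slack` (the tower door's `hΔ`); `sum_Ico_nonneg` (its `hΔ0`).
§1 `measurableSet_targetsAbove`; ★★`gibbsK_preimage_le_of_oneStepLetters` — THE RUN-LEVEL INDUCTION: `Gibbs_K {descendTo_j ∈ A} ≤ e^{Σ_{[j,Ts)} η} · Gibbs_K {descendTo_j ∈ A,
   descendTo_i ∈ T_i ∀ i ∈ (j,Ts]}` for every measurable `A ⊆ D_j` (for `j ≥ Ts` the exponent is the empty sum).
§2 `withDensity_restrict_le_of_forall_le`, `ae_restrict_le_of_withDensity_restrict_le` [folklore]; ★★★`run_le_exp_mul_cutTower_of_oneStepLetters` — TOWER FORM: for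
   ANY tower `μ` (`μ j = ν K j` for `j ≥ Ts`, `μ j = (descend j)_*((μ (j+1))·(ofReal ∘ χ_{j+1}))` below, `χ` real MEASURABLE — the line's `sfCut` is,
   ✓`RunPairOrgan.measurable_sfCut`) with `χ_i = 1` on `T_i` (`j < i ≤ Ts`): `ν K j (A) ≤ e^{Σ_{[j,Ts)} η} · μ j (A)` for measurable `A ⊆ D_j`;
   ★★`density_ae_le_on_domain_of_oneStepLetters` — densities `ρᵗ` of `ν K j` (measurable), `ρᶜ ≥ 0` of `μ j`: `ρᵗ ≤ e^{Δ_j}ρᶜ` `dU_j`-a.e. on `D_j`;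
   ★★`density_le_on_open_of_oneStepLetters` — EVERYWHERE on open `O ⊆ D_j` where both are continuous (✓`…S1aInvariantVersion.le_on_of_ae_le_of_continuousOn`: product Haar
   charges open sets); ★★★`hdomBG_of_oneStepLetters` — THE `hdomBG_j` BINDER OF THE TOWER DOOR OF RECORD VERBATIM (✓p831345 l.86–90 with `θ := θBal F.L γ b₀ p₀ j`; dock
   certified by `example` in the seat's HOME slot), from: the letters `(L_i)` (`j ≤ i < Ts`), `Σ_{[j,Ts)} η_i ≤ Δ_j`, `D_j` OPEN, and the supplier's inclusion `hgood` «every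
   (E)-good datum, read back through `fieldShift (heightShift_eq F hjK)`, lies in `D_j`».
§3 sanity: `oneStepLetter_of_nesting` — deterministic nesting `descend_i⁻¹ D_i ⊆ T_{i+1}` is the case `η_i = 0` (print's (47) derivation keeps every `χ_i` inside the next plateau;
   for the line's (½, 24∕25) datum windows this FAILS at `L = 3`, UV3-NODE §69.17 — whence the conditional-probability form with room for `η_i > 0`).

THE RESIDUAL, NAMED (★p1 «every gap named»; nothing below is asserted).  After this file the analytic content of `hdomBG_j` is EXACTLY the family `(L_i)`: per height `i`, a
relative large-field bound for ONE renormalisation step of run `K` over good data — in density currency `∫_{fibre(V) ∖ T_{i+1}} ρ_{i+1} dλ_V ≤ (1 − e^{−η_i}) ∫_{fibre(V)} ρ_{i+1} dλ_V`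
for a.e. good `V` (the set form above is its disintegration-free equivalent).  Its inputs in print: the class bounds at heights `i`, `i+1` for the RUN ((41) upper ∕ `large` off the
plateau, (47) lower near the fibre minimiser — the (α)-package's `Φ_m(ρᵗ)`), the CLASSICAL COERCIVITY of the background action on the one-step fibre ([Balaban1985BackgroundPropagators]
§3 Thms 3.11∕3.12 — the (W-acc) letter of ✓p828894, «MISSING in the tree» per UV3-NODE §92.2 L2-a), and fibre entropy (`|T|·log θ⁻¹`); geometric size `η_i ≤ c·q^i` is what §0 then
turns into the door's budget.  HONEST: bookkeeping over landed kernel facts; `hdomBG_j` is REDUCED, not discharged; every `η_i`, `D_i`, `T_i`, `hgood` is the supplier's;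
(m) AS TYPED suspect-false at `L = 3` (RULING №105), (m)_E OPEN; the (α) package UNINHABITED; the five registered stubs (3732b7df) ∕ 20520 ∕ 19936 ∕ 19200 ∕ `YM3TorusSU2` NOT
proved; rung R3 = SU(2) YM₃ on T³ at fixed lattice data — NOT d = 4, NOT infinite volume, NOT a mass gap, NOT Clay.  Sorry-free, axioms standard.
References: [Balaban1985UV3] CMP 102 (1985) (7) p.257, (41) p.266, (47) p.267; [Balaban1987RG1] CMP 109 (1987) (0.11) p.253; [Balaban1985BackgroundPropagators] CMP 99 §3.
-/

set_option autoImplicit false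

noncomputable section

namespace Summit.QuantumFields.YangMills.Theorems.FluctuationComparisonRegPrIntLS1aDomBGOfOneStepLetters

open MeasureTheory Filter Topology Set Function
open scoped ENNReal NNReal
open Literature.MathematicalPhysics.QuantumFieldTheory.Balaban1983to89
open T3ContinuumYM3Torus T3NestedUnitLaws T3UnitLawDensityEML T3UnitScaleTilt T3LevelShift T3TiltDescent T4Continuum BalabanUVClass
open Literature.MathematicalPhysics.QuantumFieldTheory.Balaban1983to89.Missing
open Literature.MathematicalPhysics.QuantumFieldTheory.Balaban1983to89.T3DescentFibreTower (descendTo_descendTo descendTo_self)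
open scoped Literature.MathematicalPhysics.QuantumFieldTheory.Balaban1983to89.T3OrbitAverage
open Summit.QuantumFields.YangMills.Theorems.FluctuationComparisonRegPrIntLOrganTangentFibredChartDescendTo (descend_eq_descendTo')
open Summit.QuantumFields.YangMills.Theorems.FluctuationComparisonRegPrIntLS1aTowerLawSandwich
  (run_eq_map_descendTo map_restrict_le_tower ae_le_of_withDensity_le)
open Summit.QuantumFields.YangMills.Theorems.FluctuationComparisonRegPrIntLS1aInvariantVersion (le_on_of_ae_le_of_continuousOn)

/-! ## §0 Two real-number one-liners: splitting off the bottom step of the exponent, and the geometric tail budget -/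

section Numbers

/-- `e^{Σ_{[j,Ts)} η} = e^{η_j} · e^{Σ_{[j+1,Ts)} η}` in `ℝ≥0∞` (`j < Ts`). [folklore] -/
theorem ofReal_exp_sum_Ico_succ (η : ℕ → ℝ) {j Ts : ℕ} (h : j < Ts) :
    ENNReal.ofReal (Real.exp (∑ i ∈ Finset.Ico j Ts, η i)) =
      ENNReal.ofReal (Real.exp (η j)) * ENNReal.ofReal (Real.exp (∑ i ∈ Finset.Ico (j + 1) Ts, η i)) := by
  rw [Finset.sum_eq_sum_Ico_succ_bot h, Real.exp_add, ENNReal.ofReal_mul (Real.exp_nonneg _)]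

/-- **THE BUDGET OF THE INDUCTIVE FORM**: per-step letters of geometric size `η_i ≤ c·q^i` (`0 ≤ q < 1`, `0 ≤ c`) sum to a geometrically small
domination exponent `Σ_{i ∈ [j,Ts)} η_i ≤ (c∕(1−q))·q^j` — the shape `Δ_j ≤ S₁·q₁^j` consumed by ✓`…S1aMemOfDominated.admissible_add_slack`, UNIFORM in the
seed height `Ts`. [folklore] -/
theorem sum_Ico_le_geom {η : ℕ → ℝ} {c q : ℝ} (hq0 : 0 ≤ q) (hq1 : q < 1) (hc : 0 ≤ c) (hη : ∀ i, η i ≤ c * q ^ i) (j Ts : ℕ) :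
    ∑ i ∈ Finset.Ico j Ts, η i ≤ c / (1 - q) * q ^ j := by
  calc ∑ i ∈ Finset.Ico j Ts, η i ≤ ∑ i ∈ Finset.Ico j Ts, c * q ^ i := Finset.sum_le_sum fun i _ => hη i
    _ = c * ∑ i ∈ Finset.Ico j Ts, q ^ i := (Finset.mul_sum _ _ _).symm
    _ ≤ c * (q ^ j / (1 - q)) := mul_le_mul_of_nonneg_left (geom_sum_Ico_le_of_lt_one hq0 hq1) hc
    _ = c / (1 - q) * q ^ j := by ring

/-- Non-negative letters give a non-negative exponent. [folklore] -/
theorem sum_Ico_nonneg {η : ℕ → ℝ} (hη : ∀ i, 0 ≤ η i) (j Ts : ℕ) : 0 ≤ ∑ i ∈ Finset.Ico j Ts, η i :=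
  Finset.sum_nonneg fun i _ => hη i

end Numbers

/-! ## §1 The run-level induction: the Gibbs mass over a good datum concentrates on the good plateaus of every intermediate height -/

section Run

variable (F : T3Family) {γ : ℝ}
  (ν : ℕ → (j : ℕ) → Measure (GaugeField (F.P j) 0 ↥(Matrix.specialUnitaryGroup (Fin 2) ℂ)))
  {K Ts : ℕ}
  (D T : (i : ℕ) → Set (GaugeField (F.P i) 0 ↥(Matrix.specialUnitaryGroup (Fin 2) ℂ)))

/-- The event «the history of run `K` sits in the target set `T_i` at every height `i ∈ (j, Ts]`» is measurable (targets measurable; lit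
✓`measurable_descendTo`). [cite: Balaban1985UV3, (7) p.257] -/
theorem measurableSet_targetsAbove (hTm : ∀ i, MeasurableSet (T i)) (j : ℕ) :
    MeasurableSet {U : GaugeField (F.P K) 0 ↥(Matrix.specialUnitaryGroup (Fin 2) ℂ) |
      ∀ (i : ℕ), j < i → i ≤ Ts → ∀ (hiK : i ≤ K), descendTo F ℰp i K hiK U ∈ T i} := by
  rw [Set.setOf_forall]
  refine MeasurableSet.iInter fun i => ?_
  by_cases h : j < i ∧ i ≤ Ts ∧ i ≤ K
  · have e : {U : GaugeField (F.P K) 0 ↥(Matrix.specialUnitaryGroup (Fin 2) ℂ) |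
        j < i → i ≤ Ts → ∀ (hiK : i ≤ K), descendTo F ℰp i K hiK U ∈ T i} = descendTo F ℰp i K h.2.2 ⁻¹' T i := by
      ext U
      exact ⟨fun hU => hU h.1 h.2.1 h.2.2, fun hU _ _ _ => hU⟩
    rw [e]
    exact measurable_descendTo F ℰp measurableE_ℰp h.2.2 (hTm i)
  · have e : {U : GaugeField (F.P K) 0 ↥(Matrix.specialUnitaryGroup (Fin 2) ℂ) |
        j < i → i ≤ Ts → ∀ (hiK : i ≤ K), descendTo F ℰp i K hiK U ∈ T i} = univ := by
      ext U
      simp only [mem_setOf_eq, mem_univ, iff_true]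
      exact fun h1 h2 h3 => (h ⟨h1, h2, h3⟩).elim
    rw [e]
    exact MeasurableSet.univ

/-- ★★ **THE RUN-LEVEL INDUCTION.**  For the run system `ν` of S1aᴴ (`ν K K = Gibbs_K`, `ν K j = (descend j)_* ν K (j+1)`), DOMAINS `D_i` and measurable TARGETS
`T_i ⊆ D_i`, and ONE-STEP CONDITIONAL PLATEAU LETTERS on the run's consecutive laws for the heights `j ≤ i < Ts` —
`(L_i)  ν K (i+1) {U | descend_i U ∈ A} ≤ e^{η_i} · ν K (i+1) {U | descend_i U ∈ A, U ∈ T_{i+1}}` for every measurable `A ⊆ D_i`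
(«given that the height-`i` average is a good datum, the height-`(i+1)` average lies on the good plateau with conditional probability `≥ e^{−η_i}`») —
the Gibbs mass of run `K` over every measurable `A ⊆ D_j` is at most `e^{Σ_{i∈[j,Ts)} η_i}` times its mass over `A` with the WHOLE history on the targets:
`Gibbs_K {descendTo_j ∈ A} ≤ e^{Δ_j} · Gibbs_K {descendTo_j ∈ A, descendTo_i ∈ T_i (j < i ≤ Ts)}`.  Downward induction on `Ts − j` through lit ✓`descendTo_descendTo`
(`descend_j ∘ descendTo_{j+1} = descendTo_j`) — no disintegration, no fibre integral.  Nothing of Bałaban's asserted: every `η_i` is a HYPOTHESIS.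
[cite: Balaban1985UV3, (7) p.257 and (47) p.267] -/
theorem gibbsK_preimage_le_of_oneStepLetters
    (hν1 : ∀ K, ν K K = T4GenFunBounds.gibbsMeasure (F.P K) ((F.scheme ℰp γ).β K))
    (hν2 : ∀ K j, j < K → ν K j = Measure.map (descend F ℰp j) (ν K (j + 1)))
    (hTs : Ts ≤ K) (hTm : ∀ i, MeasurableSet (T i)) (hTD : ∀ i, T i ⊆ D i) (η : ℕ → ℝ) {j : ℕ} (hjK : j ≤ K)
    (hstep : ∀ (i : ℕ), j ≤ i → i < Ts → ∀ A : Set (GaugeField (F.P i) 0 ↥(Matrix.specialUnitaryGroup (Fin 2) ℂ)), MeasurableSet A → A ⊆ D i →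
      ν K (i + 1) (descend F ℰp i ⁻¹' A) ≤ ENNReal.ofReal (Real.exp (η i)) * ν K (i + 1) (descend F ℰp i ⁻¹' A ∩ T (i + 1)))
    {A : Set (GaugeField (F.P j) 0 ↥(Matrix.specialUnitaryGroup (Fin 2) ℂ))} (hA : MeasurableSet A) (hAD : A ⊆ D j) :
    gibbsK F ℰp γ K (descendTo F ℰp j K hjK ⁻¹' A) ≤
      ENNReal.ofReal (Real.exp (∑ i ∈ Finset.Ico j Ts, η i)) *
        gibbsK F ℰp γ K (descendTo F ℰp j K hjK ⁻¹' A ∩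
          {U | ∀ (i : ℕ), j < i → i ≤ Ts → ∀ (hiK : i ≤ K), descendTo F ℰp i K hiK U ∈ T i}) := by
  -- above the seed height there is nothing to prove
  rcases le_or_gt Ts j with hTj | hjT
  · have e : descendTo F ℰp j K hjK ⁻¹' A ∩
        {U | ∀ (i : ℕ), j < i → i ≤ Ts → ∀ (hiK : i ≤ K), descendTo F ℰp i K hiK U ∈ T i} = descendTo F ℰp j K hjK ⁻¹' A := by
      refine inter_eq_left.mpr fun U _ => ?_
      simp only [mem_setOf_eq]
      intro i h1 h2; omega
    rw [e, Finset.Ico_eq_empty_of_le hTj, Finset.sum_empty, Real.exp_zero, ENNReal.ofReal_one, one_mul]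
  -- below it: downward induction on `n = Ts − j`
  suffices h : ∀ (n j : ℕ) (hjK : j ≤ K), j + n = Ts →
      (∀ (i : ℕ), j ≤ i → i < Ts → ∀ A : Set (GaugeField (F.P i) 0 ↥(Matrix.specialUnitaryGroup (Fin 2) ℂ)), MeasurableSet A → A ⊆ D i →
        ν K (i + 1) (descend F ℰp i ⁻¹' A) ≤ ENNReal.ofReal (Real.exp (η i)) * ν K (i + 1) (descend F ℰp i ⁻¹' A ∩ T (i + 1))) →
      ∀ A : Set (GaugeField (F.P j) 0 ↥(Matrix.specialUnitaryGroup (Fin 2) ℂ)), MeasurableSet A → A ⊆ D j →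
        gibbsK F ℰp γ K (descendTo F ℰp j K hjK ⁻¹' A) ≤
          ENNReal.ofReal (Real.exp (∑ i ∈ Finset.Ico j Ts, η i)) *
            gibbsK F ℰp γ K (descendTo F ℰp j K hjK ⁻¹' A ∩
              {U | ∀ (i : ℕ), j < i → i ≤ Ts → ∀ (hiK : i ≤ K), descendTo F ℰp i K hiK U ∈ T i}) from
    h (Ts - j) j hjK (by omega) hstep A hA hAD
  intro n
  induction n with
  | zero =>
    intro j hjK hj _ A _ _
    rw [add_zero] at hj
    subst hj
    have e : descendTo F ℰp j K hjK ⁻¹' A ∩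
        {U | ∀ (i : ℕ), j < i → i ≤ j → ∀ (hiK : i ≤ K), descendTo F ℰp i K hiK U ∈ T i} = descendTo F ℰp j K hjK ⁻¹' A := by
      refine inter_eq_left.mpr fun U _ => ?_
      simp only [mem_setOf_eq]
      intro i h1 h2; omega
    rw [e, Finset.Ico_self, Finset.sum_empty, Real.exp_zero, ENNReal.ofReal_one, one_mul]
  | succ n ih =>
    intro j hjK hj hstep A hA hAD
    have hjT : j < Ts := by omega
    have hjK' : j + 1 ≤ K := by omega
    have hd : Measurable (descend F ℰp j : GaugeField (F.P (j + 1)) 0 ↥(Matrix.specialUnitaryGroup (Fin 2) ℂ) →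
        GaugeField (F.P j) 0 ↥(Matrix.specialUnitaryGroup (Fin 2) ℂ)) := measurable_descend F ℰp measurableE_ℰp j
    have hD : Measurable (descendTo F ℰp (j + 1) K hjK' : GaugeField (F.P K) 0 ↥(Matrix.specialUnitaryGroup (Fin 2) ℂ) →
        GaugeField (F.P (j + 1)) 0 ↥(Matrix.specialUnitaryGroup (Fin 2) ℂ)) := measurable_descendTo F ℰp measurableE_ℰp hjK'
    -- `descend_j ∘ descendTo_{j+1} = descendTo_j`
    have e1 : ∀ U : GaugeField (F.P K) 0 ↥(Matrix.specialUnitaryGroup (Fin 2) ℂ),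
        descend F ℰp j (descendTo F ℰp (j + 1) K hjK' U) = descendTo F ℰp j K hjK U := fun U => by
      rw [descend_eq_descendTo' F j (Nat.le_succ j), descendTo_descendTo]
    -- the run law at height `j+1` is the descended Gibbs measure
    have hrun : ν K (j + 1) = Measure.map (descendTo F ℰp (j + 1) K hjK') (gibbsK F ℰp γ K) := run_eq_map_descendTo F ν hν1 hν2 hjK'
    -- the new good set one level up
    set S : Set (GaugeField (F.P (j + 1)) 0 ↥(Matrix.specialUnitaryGroup (Fin 2) ℂ)) := descend F ℰp j ⁻¹' A ∩ T (j + 1) with hS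
    have hSm : MeasurableSet S := (hA.preimage hd).inter (hTm (j + 1))
    have hSD : S ⊆ D (j + 1) := fun U hU => hTD (j + 1) hU.2
    -- the one-step letter at height `j`
    have hL := hstep j le_rfl hjT A hA hAD
    rw [hrun, Measure.map_apply hD (hA.preimage hd), Measure.map_apply hD hSm] at hL
    have e2 : descendTo F ℰp (j + 1) K hjK' ⁻¹' (descend F ℰp j ⁻¹' A) = descendTo F ℰp j K hjK ⁻¹' A := by
      ext U
      simp only [mem_preimage, e1]
    rw [e2] at hL
    -- the induction hypothesis one level up, at the good set `S`
    have hIH := ih (j + 1) hjK' (by omega) (fun i hi hiT => hstep i (by omega) hiT) S hSm hSD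
    -- the history events agree
    have e3 : descendTo F ℰp (j + 1) K hjK' ⁻¹' S ∩
          {U | ∀ (i : ℕ), j + 1 < i → i ≤ Ts → ∀ (hiK : i ≤ K), descendTo F ℰp i K hiK U ∈ T i} =
        descendTo F ℰp j K hjK ⁻¹' A ∩
          {U | ∀ (i : ℕ), j < i → i ≤ Ts → ∀ (hiK : i ≤ K), descendTo F ℰp i K hiK U ∈ T i} := by
      ext U
      simp only [hS, mem_inter_iff, mem_preimage, mem_setOf_eq, e1]
      constructor
      · rintro ⟨⟨hUA, hUT⟩, hU⟩
        refine ⟨hUA, fun i h1 h2 hiK => ?_⟩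
        rcases Nat.lt_or_ge (j + 1) i with h3 | h3
        · exact hU i h3 h2 hiK
        · have hi : i = j + 1 := by omega
          subst hi
          exact hUT
      · rintro ⟨hUA, hU⟩
        exact ⟨⟨hUA, hU (j + 1) (by omega) (by omega) hjK'⟩, fun i h1 h2 hiK => hU i (by omega) h2 hiK⟩
    rw [e3] at hIH
    calc gibbsK F ℰp γ K (descendTo F ℰp j K hjK ⁻¹' A)
        ≤ ENNReal.ofReal (Real.exp (η j)) * gibbsK F ℰp γ K (descendTo F ℰp (j + 1) K hjK' ⁻¹' S) := hL
      _ ≤ ENNReal.ofReal (Real.exp (η j)) * (ENNReal.ofReal (Real.exp (∑ i ∈ Finset.Ico (j + 1) Ts, η i)) *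
            gibbsK F ℰp γ K (descendTo F ℰp j K hjK ⁻¹' A ∩
              {U | ∀ (i : ℕ), j < i → i ≤ Ts → ∀ (hiK : i ≤ K), descendTo F ℰp i K hiK U ∈ T i})) := mul_le_mul_right hIH _
      _ = ENNReal.ofReal (Real.exp (∑ i ∈ Finset.Ico j Ts, η i)) *
            gibbsK F ℰp γ K (descendTo F ℰp j K hjK ⁻¹' A ∩
              {U | ∀ (i : ℕ), j < i → i ≤ Ts → ∀ (hiK : i ≤ K), descendTo F ℰp i K hiK U ∈ T i}) := by
          rw [← mul_assoc, ← ofReal_exp_sum_Ico_succ η hjT]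

end Run

/-! ## §2 The tower form and the density forms, down to the `hdomBG_j` binder of the tower door of record -/

section Tower

/-- From «`ν A ≤ c · μ A` for every measurable `A ⊆ D`» to the `withDensity` inequality on `D` for real densities. [folklore] -/
theorem withDensity_restrict_le_of_forall_le {P : Params} {j : ℕ}
    {ν' μ' : Measure (GaugeField P j ↥(Matrix.specialUnitaryGroup (Fin 2) ℂ))} {ρt ρc : GaugeField P j ↥(Matrix.specialUnitaryGroup (Fin 2) ℂ) → ℝ}
    (hνt : ν' = (fieldMeasure P j ↥(Matrix.specialUnitaryGroup (Fin 2) ℂ)).withDensity fun V => ENNReal.ofReal (ρt V))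
    (hμc : μ' = (fieldMeasure P j ↥(Matrix.specialUnitaryGroup (Fin 2) ℂ)).withDensity fun V => ENNReal.ofReal (ρc V))
    {D' : Set (GaugeField P j ↥(Matrix.specialUnitaryGroup (Fin 2) ℂ))} (hDm : MeasurableSet D') {c : ℝ≥0∞}
    (h : ∀ A, MeasurableSet A → A ⊆ D' → ν' A ≤ c * μ' A) :
    ((fieldMeasure P j ↥(Matrix.specialUnitaryGroup (Fin 2) ℂ)).restrict D').withDensity (fun V => ENNReal.ofReal (ρt V)) ≤
      ((fieldMeasure P j ↥(Matrix.specialUnitaryGroup (Fin 2) ℂ)).restrict D').withDensity (fun V => c * ENNReal.ofReal (ρc V)) := by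
  refine Measure.le_iff.mpr fun s hs => ?_
  have h1 := h (s ∩ D') (hs.inter hDm) inter_subset_right
  rw [hνt, hμc, withDensity_apply _ (hs.inter hDm), withDensity_apply _ (hs.inter hDm)] at h1
  rw [withDensity_apply _ hs, withDensity_apply _ hs, Measure.restrict_restrict hs]
  exact h1.trans (lintegral_const_mul_le _ _)

/-- From the `withDensity` inequality on `D` to the a.e. inequality of the real densities on `D` (`ρt` measurable, `ρc ≥ 0`, `0 ≤ c` real). [folklore] -/
theorem ae_restrict_le_of_withDensity_restrict_le {P : Params} {j : ℕ}
    {ρt ρc : GaugeField P j ↥(Matrix.specialUnitaryGroup (Fin 2) ℂ) → ℝ} (htm : Measurable ρt) (hc0 : ∀ V, 0 ≤ ρc V)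
    {D' : Set (GaugeField P j ↥(Matrix.specialUnitaryGroup (Fin 2) ℂ))} {c : ℝ} (hc : 0 ≤ c)
    (h : ((fieldMeasure P j ↥(Matrix.specialUnitaryGroup (Fin 2) ℂ)).restrict D').withDensity (fun V => ENNReal.ofReal (ρt V)) ≤
      ((fieldMeasure P j ↥(Matrix.specialUnitaryGroup (Fin 2) ℂ)).restrict D').withDensity (fun V => ENNReal.ofReal c * ENNReal.ofReal (ρc V))) :
    ∀ᵐ V ∂(fieldMeasure P j ↥(Matrix.specialUnitaryGroup (Fin 2) ℂ)).restrict D', ρt V ≤ c * ρc V := by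
  haveI : IsProbabilityMeasure (fieldMeasure P j ↥(Matrix.specialUnitaryGroup (Fin 2) ℂ)) := Missing.isProbabilityMeasure_fieldMeasure P j
  have hae := ae_le_of_withDensity_le (μ := (fieldMeasure P j ↥(Matrix.specialUnitaryGroup (Fin 2) ℂ)).restrict D')
    (ENNReal.measurable_ofReal.comp htm) h
  filter_upwards [hae] with V hV
  have hV' : ENNReal.ofReal (ρt V) ≤ ENNReal.ofReal (c * ρc V) := by rwa [ENNReal.ofReal_mul hc]
  exact (ENNReal.ofReal_le_ofReal_iff (mul_nonneg hc (hc0 V))).mp hV'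

variable (F : T3Family) {γ : ℝ}
  (ν : ℕ → (j : ℕ) → Measure (GaugeField (F.P j) 0 ↥(Matrix.specialUnitaryGroup (Fin 2) ℂ)))
  {K Ts : ℕ}
  (μ : (j : ℕ) → Measure (GaugeField (F.P j) 0 ↥(Matrix.specialUnitaryGroup (Fin 2) ℂ)))
  (χ : (i : ℕ) → GaugeField (F.P i) 0 ↥(Matrix.specialUnitaryGroup (Fin 2) ℂ) → ℝ)
  (D T : (i : ℕ) → Set (GaugeField (F.P i) 0 ↥(Matrix.specialUnitaryGroup (Fin 2) ℂ)))
  -- S1aᴴ's run system and a cut tower with MEASURABLE real weights (the line's `sfCut` is: ✓`RunPairOrgan.measurable_sfCut`)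
  (hν1 : ∀ K, ν K K = T4GenFunBounds.gibbsMeasure (F.P K) ((F.scheme ℰp γ).β K))
  (hν2 : ∀ K j, j < K → ν K j = Measure.map (descend F ℰp j) (ν K (j + 1)))
  (hTs : Ts ≤ K) (hχm : ∀ i, Measurable (χ i))
  (hanch : ∀ j, Ts ≤ j → μ j = ν K j)
  (hcut : ∀ j, j < Ts → μ j = Measure.map (descend F ℰp j) ((μ (j + 1)).withDensity fun U => ENNReal.ofReal (χ (j + 1) U)))
  -- the supplier's targets sit inside the domains and ON THE PLATEAU of the cut weights; the one-step letters `(L_i)` for `j ≤ i < Ts`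
  (hTm : ∀ i, MeasurableSet (T i)) (hTD : ∀ i, T i ⊆ D i) (η : ℕ → ℝ) {j : ℕ} (hjK : j ≤ K)
  (hplat : ∀ (i : ℕ), j < i → i ≤ Ts → ∀ U ∈ T i, χ i U = 1)
  (hstep : ∀ (i : ℕ), j ≤ i → i < Ts → ∀ A : Set (GaugeField (F.P i) 0 ↥(Matrix.specialUnitaryGroup (Fin 2) ℂ)), MeasurableSet A → A ⊆ D i →
    ν K (i + 1) (descend F ℰp i ⁻¹' A) ≤ ENNReal.ofReal (Real.exp (η i)) * ν K (i + 1) (descend F ℰp i ⁻¹' A ∩ T (i + 1)))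

include hν1 hν2 hTs hχm hanch hcut hTm hTD hjK hplat hstep

/-- ★★★ **THE ONE-STEP INDUCTIVE FORM OF THE DOMINATION, TOWER VERSION.**  Run system `ν`; ANY tower `μ` equal to `ν K` from `Ts` up and cut below `Ts` by measurable
real weights `χ` (`μ j = (descend j)_*((μ (j+1))·(ofReal ∘ χ_{j+1}))`); domains `D_i`, measurable targets `T_i ⊆ D_i` ON THE PLATEAU (`χ_i = 1` on `T_i`, `j < i ≤ Ts`);
and the one-step conditional plateau letters `(L_i)` of ✓`gibbsK_preimage_le_of_oneStepLetters` for `j ≤ i < Ts`.  THEN for every measurable `A ⊆ D_j`: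
`ν K j (A) ≤ e^{Σ_{i∈[j,Ts)} η_i} · μ j (A)` — the run's law is dominated by the cut tower's law on the good data, up to the summed one-step exponents
(§1 + px21's ✓`…S1aTowerLawSandwich.map_restrict_le_tower` at `E :=` «history on the targets»).  Nothing of Bałaban's asserted; every `η_i` is a HYPOTHESIS.
[cite: Balaban1985UV3, (7) p.257, (41) p.266 and (47) p.267] -/
theorem run_le_exp_mul_cutTower_of_oneStepLetters
    {A : Set (GaugeField (F.P j) 0 ↥(Matrix.specialUnitaryGroup (Fin 2) ℂ))} (hA : MeasurableSet A) (hAD : A ⊆ D j) :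
    ν K j A ≤ ENNReal.ofReal (Real.exp (∑ i ∈ Finset.Ico j Ts, η i)) * μ j A := by
  have hD : Measurable (descendTo F ℰp j K hjK : GaugeField (F.P K) 0 ↥(Matrix.specialUnitaryGroup (Fin 2) ℂ) →
      GaugeField (F.P j) 0 ↥(Matrix.specialUnitaryGroup (Fin 2) ℂ)) := measurable_descendTo F ℰp measurableE_ℰp hjK
  have hH := measurableSet_targetsAbove F T (K := K) (Ts := Ts) hTm j
  -- the run side: §1
  have h1 := gibbsK_preimage_le_of_oneStepLetters F ν D T hν1 hν2 hTs hTm hTD η hjK hstep hA hAD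
  rw [run_eq_map_descendTo F ν hν1 hν2 hjK, Measure.map_apply hD hA]
  refine h1.trans (mul_le_mul_right ?_ _)
  -- the tower side: the restricted descended Gibbs measure lies below `μ j`
  rw [← Measure.restrict_apply (hA.preimage hD), ← Measure.map_apply hD hA]
  refine Measure.le_iff.mp (map_restrict_le_tower F (fun i U => ENNReal.ofReal (χ i U)) ν μ
    (fun i => ENNReal.measurable_ofReal.comp (hχm i)) hν1 hν2 hTs hanch (fun j hj => hcut j hj) hH hjK ?_) A hA
  intro U hU i hji hiT
  show ENNReal.ofReal (χ i (descendTo F ℰp i K (hiT.trans hTs) U)) = 1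
  rw [hplat i hji hiT _ (hU i hji hiT (hiT.trans hTs)), ENNReal.ofReal_one]

/-- ★★ **DENSITY FORM, A.E. ON THE DOMAIN**: with densities `ν K j = dU_j·(ofReal ∘ ρᵗ)` (`ρᵗ` measurable) and `μ j = dU_j·(ofReal ∘ ρᶜ)` (`ρᶜ ≥ 0`) and `D_j` measurable,
the one-step letters give `ρᵗ ≤ e^{Σ_{i∈[j,Ts)} η_i} · ρᶜ` for `dU_j`-almost every `V ∈ D_j`. [cite: Balaban1985UV3, (41) p.266 and (47) p.267] -/
theorem density_ae_le_on_domain_of_oneStepLetters (hDm : MeasurableSet (D j))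
    {ρc ρt : GaugeField (F.P j) 0 ↥(Matrix.specialUnitaryGroup (Fin 2) ℂ) → ℝ} (htm : Measurable ρt) (hc0 : ∀ V, 0 ≤ ρc V)
    (hμc : μ j = (fieldMeasure (F.P j) 0 ↥(Matrix.specialUnitaryGroup (Fin 2) ℂ)).withDensity fun V => ENNReal.ofReal (ρc V))
    (hνt : ν K j = (fieldMeasure (F.P j) 0 ↥(Matrix.specialUnitaryGroup (Fin 2) ℂ)).withDensity fun V => ENNReal.ofReal (ρt V)) :
    ∀ᵐ V ∂(fieldMeasure (F.P j) 0 ↥(Matrix.specialUnitaryGroup (Fin 2) ℂ)).restrict (D j), ρt V ≤ Real.exp (∑ i ∈ Finset.Ico j Ts, η i) * ρc V :=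
  ae_restrict_le_of_withDensity_restrict_le htm hc0 (Real.exp_nonneg _)
    (withDensity_restrict_le_of_forall_le hνt hμc hDm fun _ hA hAD =>
      run_le_exp_mul_cutTower_of_oneStepLetters F ν μ χ D T hν1 hν2 hTs hχm hanch hcut hTm hTD η hjK hplat hstep hA hAD)

/-- ★★ **DENSITY FORM, EVERYWHERE ON OPEN SUBSETS**: on any open `O ⊆ D_j` (`D_j` measurable) on which both densities are continuous (`ρᶜ ≥ 0`), the domination holds
AT EVERY POINT (product Haar charges open sets: ✓`le_on_of_ae_le_of_continuousOn`). [cite: Balaban1985UV3, (41) p.266 and (47) p.267] -/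
theorem density_le_on_open_of_oneStepLetters (hDm : MeasurableSet (D j))
    {ρc ρt : GaugeField (F.P j) 0 ↥(Matrix.specialUnitaryGroup (Fin 2) ℂ) → ℝ} (htm : Measurable ρt) (hc0 : ∀ V, 0 ≤ ρc V)
    (hμc : μ j = (fieldMeasure (F.P j) 0 ↥(Matrix.specialUnitaryGroup (Fin 2) ℂ)).withDensity fun V => ENNReal.ofReal (ρc V))
    (hνt : ν K j = (fieldMeasure (F.P j) 0 ↥(Matrix.specialUnitaryGroup (Fin 2) ℂ)).withDensity fun V => ENNReal.ofReal (ρt V))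
    {O : Set (GaugeField (F.P j) 0 ↥(Matrix.specialUnitaryGroup (Fin 2) ℂ))} (hO : IsOpen O) (hOD : O ⊆ D j)
    (hcO : ContinuousOn ρc O) (htO : ContinuousOn ρt O) :
    ∀ V ∈ O, ρt V ≤ Real.exp (∑ i ∈ Finset.Ico j Ts, η i) * ρc V := by
  haveI : BorelSpace (GaugeField (F.P j) 0 ↥(Matrix.specialUnitaryGroup (Fin 2) ℂ)) := T3OrbitAverage.instBorelSpaceGaugeField
  haveI : (fieldMeasure (F.P j) 0 ↥(Matrix.specialUnitaryGroup (Fin 2) ℂ)).IsOpenPosMeasure :=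
    B12ContinuousTransportInvariance.isOpenPosMeasure_fieldMeasure_SU 2 (F.P j) 0
  have hae := density_ae_le_on_domain_of_oneStepLetters F ν μ χ D T hν1 hν2 hTs hχm hanch hcut hTm hTD η hjK hplat hstep hDm htm hc0 hμc hνt
  exact le_on_of_ae_le_of_continuousOn (μ := fieldMeasure (F.P j) 0 ↥(Matrix.specialUnitaryGroup (Fin 2) ℂ)) hO htO
    (continuousOn_const.mul hcO) (ae_restrict_of_ae_restrict_of_subset hOD hae)

/-- ★★★ **THE `hdomBG_j` BINDER OF THE TOWER DOOR OF RECORD (✓`…S1aAlphaPhiMTowerBG` l.86–90), FROM THE ONE-STEP LETTERS.**  In the door's scope (run system, `K`,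
`Ts ≤ K`, a tower cut by real weights `χ` — here also MEASURABLE, as the line's `sfCut` is — a height `j ≤ K`, continuous densities `ρᶜ ≥ 0` of `μ j` and `ρᵗ` of `ν K j`):
if the supplier's domain `D_j` is OPEN and contains (read back through `fieldShift`) every datum of the `θ`-window admitting a regular minimiser in `{PlaqSmall R₀}` with fine
plaquettes `< θ·L^{−2(K−j)}` — the (E)-good data of v19 «BACKGROUND WINDOWS» — and the one-step letters hold with `Σ_{i∈[j,Ts)} η_i ≤ Δ`, THEN
`readAtLevel ρᵗ V ≤ e^{Δ} · readAtLevel ρᶜ V` at every such datum: the letter `hdomBG_j` VERBATIM (`θ := θBal F.L γ b₀ p₀ j`, `Δ := Δ j`).  Nothing of Bałaban's asserted;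
the letters `η_i`, the sets `D_i ⊇ T_i` and the inclusion `hgood` are the supplier's. [cite: Balaban1985UV3, (41) p.266 and (47) p.267] -/
theorem hdomBG_of_oneStepLetters (hDo : IsOpen (D j)) {Δ : ℝ} (hΔ : ∑ i ∈ Finset.Ico j Ts, η i ≤ Δ)
    (ρc ρt : GaugeField (F.P j) 0 ↥(Matrix.specialUnitaryGroup (Fin 2) ℂ) → ℝ) (hcc : Continuous ρc) (htc : Continuous ρt) (hc0 : ∀ V, 0 ≤ ρc V)
    (hμc : μ j = (fieldMeasure (F.P j) 0 ↥(Matrix.specialUnitaryGroup (Fin 2) ℂ)).withDensity fun V => ENNReal.ofReal (ρc V))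
    (hνt : ν K j = (fieldMeasure (F.P j) 0 ↥(Matrix.specialUnitaryGroup (Fin 2) ℂ)).withDensity fun V => ENNReal.ofReal (ρt V))
    {θ R₀ : ℝ}
    (hgood : ∀ V : GaugeField (F.P K) (K - j) ↥(Matrix.specialUnitaryGroup (Fin 2) ℂ), PlaqSmall θ V →
      (∃ U₀ : GaugeField (F.P K) 0 ↥(Matrix.specialUnitaryGroup (Fin 2) ℂ),
          IsBackground (fun i => BlockAveraging.blockAvg (P := F.P K) (j := i) ℰp) {U | PlaqSmall R₀ U} (K - j) V U₀ ∧
          PlaqSmall (θ * ((F.L : ℝ)⁻¹) ^ (2 * (K - j))) U₀) →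
      fieldShift (heightShift_eq F hjK) V ∈ D j) :
    ∀ V : GaugeField (F.P K) (K - j) ↥(Matrix.specialUnitaryGroup (Fin 2) ℂ), PlaqSmall θ V →
      (∃ U₀ : GaugeField (F.P K) 0 ↥(Matrix.specialUnitaryGroup (Fin 2) ℂ),
          IsBackground (fun i => BlockAveraging.blockAvg (P := F.P K) (j := i) ℰp) {U | PlaqSmall R₀ U} (K - j) V U₀ ∧
          PlaqSmall (θ * ((F.L : ℝ)⁻¹) ^ (2 * (K - j))) U₀) →
      readAtLevel F hjK ρt V ≤ Real.exp Δ * readAtLevel F hjK ρc V := by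
  haveI : BorelSpace (GaugeField (F.P j) 0 ↥(Matrix.specialUnitaryGroup (Fin 2) ℂ)) := T3OrbitAverage.instBorelSpaceGaugeField
  have hpt := density_le_on_open_of_oneStepLetters F ν μ χ D T hν1 hν2 hTs hχm hanch hcut hTm hTD η hjK hplat hstep hDo.measurableSet
    htc.measurable hc0 hμc hνt hDo subset_rfl hcc.continuousOn htc.continuousOn
  intro V hV hex
  rw [readAtLevel_apply, readAtLevel_apply]
  exact (hpt _ (hgood V hV hex)).trans (mul_le_mul_of_nonneg_right (Real.exp_le_exp.mpr hΔ) (hc0 _))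

end Tower

/-! ## §3 Sanity reading of the letters: deterministic nesting is the case `η_i = 0` -/

section Sanity

variable (F : T3Family)
  (ν : ℕ → (j : ℕ) → Measure (GaugeField (F.P j) 0 ↥(Matrix.specialUnitaryGroup (Fin 2) ℂ)))
  {K : ℕ}
  (D T : (i : ℕ) → Set (GaugeField (F.P i) 0 ↥(Matrix.specialUnitaryGroup (Fin 2) ℂ)))

/-- **DETERMINISTIC NESTING IS THE CASE `η_i = 0`**: if EVERY fine field whose one-step average is a good datum already lies in the target (`descend_i⁻¹ D_i ⊆ T_{i+1}` — the
reading of print's (47) derivation, p.267, where each level's `χ_i` sits inside the next plateau), the one-step letter `(L_i)` holds with `η_i = 0`.  (UV3-NODE §69.17: for the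
line's (½, 24∕25) datum windows this nesting FAILS at `L = 3`; under (E) it is a statement about backgrounds, not data — whence the letters are asked in CONDITIONAL-PROBABILITY
form, with room for `η_i > 0`.) [cite: Balaban1985UV3, (47) p.267] -/
theorem oneStepLetter_of_nesting (i : ℕ) (hnest : descend F ℰp i ⁻¹' D i ⊆ T (i + 1))
    (A : Set (GaugeField (F.P i) 0 ↥(Matrix.specialUnitaryGroup (Fin 2) ℂ))) (hAD : A ⊆ D i) :
    ν K (i + 1) (descend F ℰp i ⁻¹' A) ≤ ENNReal.ofReal (Real.exp 0) * ν K (i + 1) (descend F ℰp i ⁻¹' A ∩ T (i + 1)) := by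
  rw [Real.exp_zero, ENNReal.ofReal_one, one_mul]
  exact measure_mono (subset_inter Subset.rfl fun U hU => hnest (hAD hU))

end Sanity

end Summit.QuantumFields.YangMills.Theorems.FluctuationComparisonRegPrIntLS1aDomBGOfOneStepLetters

end
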